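import Mathlib.Analysis.SpecialFunctions.Pow.Real
import Mathlib.Analysis.SpecialFunctions.Log.Basic
import Mathlib.Analysis.SpecialFunctions.Sqrt
import Mathlib.Algebra.Order.Ring.Pow
import Mathlib.Algebra.Order.Archimedean.Basic
import Literature.MathematicalPhysics.QuantumFieldTheory.Dimock2011to13.ShrinkingRadii
import HarnessLib

/-!
# Dimock, *Ultraviolet stability for QED in d = 3*, §4.1 LEMMA 17 — the STOP POINT `K` of the iteration
# (`r_k` = smallest power of `L` `≥ (−log e_k)^r`; `r_{k+1} ∈ {L⁻¹r_k, r_k}`; `∃ K < N, M r_K = L^{N−K}`;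
# `N − K` bounded independently of `N`) and §2.2 (33)–(34) — the history-dependent energy shift
# `|ε⁰_k| ≤ e_k^7` — PROVED, every «sufficiently large ∕ small» an explicit number

statement-level skeleton of published theorems with citation tags; proofs where landed; nothing here is a claim about the Yang–Mills mass gap

(Writer seat p11 = literature-prover-lit-balaban-p11-g14-0, v1.0 p320128; v1.1 (this gen, -g15-0) is DOCSTRING-ONLY: the
framing line above and the «Exponents» remark below — no declaration added, removed or changed.)

**Citation header (reproduction of PUBLISHED work).** J. Dimock, *Ultraviolet stability for QED in d = 3*,
Ann. Henri Poincaré **23** (2022) 2113–2205 (= arXiv:2009.01156v2) [Dimock2022UVStabilityQED3]. Loci below are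
arXiv-v2 PDF pages `p.NN` and text-layer lines `Lnn` of the held layer `paper:arxiv-2009.01156`.

**Setting (§2.1 (7), p.2 L63–68).** The running coupling is `e_k = L^{-(N-k)/2} e`; it is the tree's
`runningCoupling ρ e N k = e·ρ^{N-k}` (file `ShrinkingRadii.lean`) at `ρ = (√L)⁻¹`, so that
`−log e_k = −log e + (N−k)·½log L` (`negLogCoupling`, proved equal in `negLogCoupling_eq`). p.3 L7–8: *"r_j ≈ (−log e_j)^r
for a positive integer r; more precisely it is the smallest power of L greater than or equal to (−log e_j)^r"*; `M = L^m`
(Prop. 1, p.6 L32–33).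

**What is reproduced, AS PRINTED.**
* §4.1 p.54 L79–84: *"We stop the iteration when our `M r_k` cubes no longer give a partition of the torus `T⁰_{N−k}`. They do
  give a partition if `M r_k ≤ L^{N−k}` (or with `M = L^m` if `r_k ≤ L^{N−k−m}`). In fact there are indices `k = K` such
  that `M r_K = L^{N−K}` exactly, and we take the first such. The existence of `K` is demonstrated in lemma 17 to follow,
  and it is shown that `N − K` is bounded in `N`."*
* **LEMMA 17** (statement p.56 L61–67, proof p.56 L68–p.57 L18): *"Let `r_k` be the smallest power of `L` greater than or equal to `r⁰_k = (−log e_k)^r`.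
  1. `r_{k+1} = L^{−1} r_k` or `r_k`.  2. There is a `K < N` so `M r_K = L^{N−K}` so `|T⁰_{N−K}| = (M r_K)^3`.
  3. `N − K` is bounded by a constant independent of `N`, as are `|T⁰_{N−K}|` and `r_K`."* — with the printed proof:
  (418) `½L⁻¹ r_k ≤ ½ r⁰_k ≤ r⁰_{k+1} ≤ r_{k+1}` *"for `e_k` sufficiently small"* (here: `e_k ≤ L^{−r}`, i.e.
  `r·log L ≤ −log e_k`, via Bernoulli's inequality), (419) `d_k = (N−k) − log_L r_k − m` *"starts out positive for `N`
  sufficiently large … eventually goes negative at `k = N`. Since `log_L r_k` only decreases by 0, 1 there must be a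
  point `k = K` where `d_K = 0`"* (a discrete intermediate-value step, `exists_zero_of_unit_steps`), and (420)
  *"`x = N − K` satisfies an inequality of the form `x ≤ r log_L(a + bx) + c` … hence … bounded by a constant independent
  of `N`"* — here with the EXPLICIT constant `2(m+1) + (−2log e + 2r log r)/log L` (`stopGap_le`), obtained from
  `log A ≤ A/r − 1 + log r` in place of the printed `L^{x}·L^{−x/2}` argument (same mechanism: logarithmic vs. linear growth).
* §2.2 (33)–(34) (p.6 L70–86): *"the extra term `ε⁰_k` in (20) now obeys the flow equation `ε⁰_{k+1} = L³(ε⁰_k + δε⁰_k)`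
  (33) and starts at zero. The increment `δε⁰_k` is allowed to depend on the history, but will satisfy the strong bound
  `|δε⁰_k| ≤ e_k^7` (or any power of `e_k`) and since `e_k^7 = L^{−7/2} e_{k+1}^7` this implies that for all `k`,
  `|ε⁰_k| ≤ e_k^7` (34)"* — proved for every power `p ≥ 7` and `L ≥ 4` (the induction needs `2L³L^{−p/2} ≤ 1`;
  *"L sufficiently large"* is a standing hypothesis of the paper, Thm 1 p.7 L53).

**Design.** Everything is PROVED; there are no named facts. The «smallest power of `L` `≥ x`» is `L^(powExp L x)` with
`powExp L x = Nat.find (∃ n, x ≤ L^n)` (§1, generic, `L ≥ 2`). The stop-point equation `M r_K = L^{N−K}` is kept in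
the printed integer form `d_K = 0` (419) (`dSeq`), and *"the first such"* `K` is then `Nat.find` of `exists_stopPoint`
(not separately named). Declared in the sub-namespace `QED3StopPoint` (it names the paper's object) to keep the generic
names (`powExp`, `radius`, `dSeq`) away from the 70-odd sibling files of this directory.

**Exponents (reading remark, v1.1).** `powExp L x` ranges over `n : ℕ`, so `r_k = L^(radiusExp …) ≥ 1` always: the
«smallest power of `L`» is read among the NONNEGATIVE powers `L⁰, L¹, …`. This is the printed situation, not a
restriction: `r⁰_k = (−log e_k)^r ≥ 1` as soon as `e_k ≤ e⁻¹`, and the paper's `r_k` are block side lengths in lattice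
units (`M r_k` cubes partition `T⁰_{N−k}`, p.54 L79–84), hence positive powers of `L`; for `x ≤ 1` one gets
`powExp L x = 0`, i.e. `r = L⁰ = 1` (`powExp_eq_zero_of_le_one`), which the paper never meets under its standing
hypothesis `e` small.

**Not here.** Nothing about the densities `ρ_k`, the regions `Π`, or Theorem 1 itself; nothing about Bałaban's papers; no
`d = 4` statement (the model is `d = 3` QED, super-renormalizable: `e_k` grows geometrically, which is exactly what makes
`r⁰_k` decrease and the stop point exist).
-/

noncomputable section

open Real

namespace Literature.MathematicalPhysics.QuantumFieldTheory.Dimock2011to13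

namespace QED3StopPoint

/-! ## §1 «the smallest power of `L` greater than or equal to `x`» -/

/-- For `L > 1` every real is below some power `L^n` (private plumbing for `powExp`). [folklore] -/
private theorem exists_le_pow {L : ℕ} (hL : 1 < L) (x : ℝ) : ∃ n : ℕ, x ≤ (L : ℝ) ^ n :=
  (pow_unbounded_of_one_lt x (by exact_mod_cast hL : (1 : ℝ) < (L : ℝ))).imp fun _ h => h.le

open Classical in
/-- `powExp L x` = the least `n : ℕ` with `x ≤ L^n` (for `L ≥ 2`; junk value `0` for `L ≤ 1`), so that
`L^(powExp L x)` is *"the smallest power of L greater than or equal to"* `x`.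
[cite: Dimock2022UVStabilityQED3, §1 p.3 L7–8 and §4.1 Lemma 17 p.56 L61–62 (arXiv:2009.01156v2)] -/
def powExp (L : ℕ) (x : ℝ) : ℕ :=
  if h : 1 < L then Nat.find (exists_le_pow h x) else 0

variable {L : ℕ} {x y : ℝ} {n : ℕ}

/-- `x ≤ L^(powExp L x)`. [cite: Dimock2022UVStabilityQED3, §4.1 Lemma 17 p.56 L61 («greater than or equal to»)] -/
theorem le_pow_powExp (hL : 1 < L) (x : ℝ) : x ≤ (L : ℝ) ^ powExp L x := by
  classical
  unfold powExp
  rw [dif_pos hL]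
  exact Nat.find_spec (exists_le_pow hL x)

/-- Minimality: `x ≤ L^n ⟹ powExp L x ≤ n`. [cite: Dimock2022UVStabilityQED3, §4.1 Lemma 17 p.56 L61 («the smallest power»)] -/
theorem powExp_le_of_le_pow (hL : 1 < L) (h : x ≤ (L : ℝ) ^ n) : powExp L x ≤ n := by
  classical
  unfold powExp
  rw [dif_pos hL]
  exact Nat.find_min' _ h

/-- Minimality, contrapositive: `n < powExp L x ⟹ L^n < x` (used as `L^{n_k−1} < r⁰_k`, i.e. `r_k ≤ L r⁰_k`, p.56 L81).
[cite: Dimock2022UVStabilityQED3, §4.1 proof of Lemma 17 p.56 L81 («r⁰_k ≤ r_k ≤ L r⁰_k»)] -/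
theorem pow_lt_of_lt_powExp (hL : 1 < L) (h : n < powExp L x) : (L : ℝ) ^ n < x := by
  by_contra hcon
  exact absurd (powExp_le_of_le_pow hL (not_lt.1 hcon)) (not_le.2 h)

/-- `powExp` is monotone in `x` («`r⁰_k` is decreasing in `k` so `r_k` is non-increasing», p.56 L70).
[cite: Dimock2022UVStabilityQED3, §4.1 proof of Lemma 17 (1) p.56 L70] -/
theorem powExp_mono (hL : 1 < L) (hxy : x ≤ y) : powExp L x ≤ powExp L y :=
  powExp_le_of_le_pow hL (hxy.trans (le_pow_powExp hL y))

/-- `x ≤ 1 ⟹ powExp L x = 0`: the smallest power of `L` `≥ x` is then `L⁰ = 1`.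
[cite: Dimock2022UVStabilityQED3, §1 p.3 L7–8 («the smallest power of L greater than or equal to»)] -/
theorem powExp_eq_zero_of_le_one (hL : 1 < L) (hx : x ≤ 1) : powExp L x = 0 :=
  Nat.le_zero.1 (powExp_le_of_le_pow hL (by simpa using hx))

/-- `1 ≤ powExp L x ⟹ (powExp L x − 1)·log L < log x` (the logarithmic form of `L^{n−1} < x`).
[cite: Dimock2022UVStabilityQED3, §4.1 proof of Lemma 17 (3) p.57 L7 («N − K ≤ log_L r⁰_K + m + 1»)] -/
theorem sub_one_mul_log_lt (hL : 1 < L) (hn : 1 ≤ powExp L x) :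
    ((powExp L x : ℝ) - 1) * Real.log L < Real.log x := by
  have hL0 : (0 : ℝ) < L := by exact_mod_cast (zero_lt_one.trans hL)
  have hlt : (L : ℝ) ^ (powExp L x - 1) < x := pow_lt_of_lt_powExp hL (by omega)
  have hpos : 0 < (L : ℝ) ^ (powExp L x - 1) := pow_pos hL0 _
  have := Real.log_lt_log hpos hlt
  rw [Real.log_pow] at this
  have hcast : ((powExp L x - 1 : ℕ) : ℝ) = (powExp L x : ℝ) - 1 := by
    rw [Nat.cast_sub hn, Nat.cast_one]
  rwa [hcast] at this

/-- THE ONE-STEP MECHANISM of Lemma 17 (1): if `y ≤ x ≤ 2y` and `L ≥ 2` then the least exponents differ by at most one,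
`powExp L y ∈ {powExp L x, powExp L x − 1}` («This inequality excludes `r_{k+1} = L^{−n} r_k` for `n ≥ 2`», p.56 L88).
[cite: Dimock2022UVStabilityQED3, §4.1 proof of Lemma 17 (1), (418) p.56 L70–88] -/
theorem powExp_step (hL : 2 ≤ L) (hyx : y ≤ x) (hxy : x ≤ 2 * y) :
    powExp L y = powExp L x ∨ powExp L y + 1 = powExp L x := by
  have hL1 : 1 < L := by omega
  have hmono := powExp_mono hL1 hyx
  suffices powExp L x ≤ powExp L y + 1 by omega
  by_contra hcon
  push Not at hcon
  have h1 : (L : ℝ) ^ (powExp L y + 1) < x := pow_lt_of_lt_powExp hL1 hcon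
  have h2 : y ≤ (L : ℝ) ^ powExp L y := le_pow_powExp hL1 y
  have hL2 : (2 : ℝ) ≤ L := by exact_mod_cast hL
  have hLn : (0 : ℝ) ≤ (L : ℝ) ^ powExp L y := pow_nonneg (by positivity) _
  have : x ≤ (L : ℝ) ^ (powExp L y + 1) :=
    calc x ≤ 2 * y := hxy
      _ ≤ 2 * (L : ℝ) ^ powExp L y := by gcongr
      _ ≤ (L : ℝ) * (L : ℝ) ^ powExp L y := mul_le_mul_of_nonneg_right hL2 hLn
      _ = (L : ℝ) ^ (powExp L y + 1) := by ring
  linarith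

/-- Bernoulli step behind «for `e_k` sufficiently small `½ r⁰_k ≤ r⁰_{k+1}`» (p.56 L77–79): for `0 ≤ b` and `2rb ≤ a`,
`½ a^r ≤ (a − b)^r`. [cite: Dimock2022UVStabilityQED3, §4.1 proof of Lemma 17 (1) p.56 L74–79] -/
theorem half_pow_le_sub_pow {a b : ℝ} {r : ℕ} (hb : 0 ≤ b) (hab : 2 * r * b ≤ a) :
    a ^ r / 2 ≤ (a - b) ^ r := by
  rcases Nat.eq_zero_or_pos r with hr | hr
  · subst hr; norm_num
  have hr1 : (1 : ℝ) ≤ r := by exact_mod_cast hr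
  have ha : 0 ≤ a := le_trans (by positivity) hab
  rcases ha.eq_or_lt with ha0 | ha0
  · -- `a = 0` forces `b = 0`
    have hb0 : b = 0 := by nlinarith
    subst hb0
    rw [← ha0, sub_zero, zero_pow hr.ne']
    norm_num
  · have hba : b / a ≤ 1 / 2 := by
      rw [div_le_iff₀ ha0]; nlinarith
    have ht : (-2 : ℝ) ≤ -(b / a) := by
      have : 0 ≤ b / a := div_nonneg hb ha0.le
      linarith
    have hB := one_add_mul_le_pow ht r
    have h3 : (1 : ℝ) / 2 ≤ 1 + r * -(b / a) := by
      have : (r : ℝ) * (b / a) ≤ 1 / 2 := by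
        rw [← mul_div_assoc, div_le_iff₀ ha0]; nlinarith
      linarith
    have har : 0 ≤ a ^ r := pow_nonneg ha r
    calc a ^ r / 2 = a ^ r * (1 / 2) := by ring
      _ ≤ a ^ r * (1 + r * -(b / a)) := mul_le_mul_of_nonneg_left h3 har
      _ ≤ a ^ r * (1 + -(b / a)) ^ r := mul_le_mul_of_nonneg_left hB har
      _ = (a * (1 + -(b / a))) ^ r := by rw [mul_pow]
      _ = (a - b) ^ r := by
        congr 1
        field_simp
        ring

/-! ## §2 The QED₃ quantities: `−log e_k`, `r⁰_k`, `r_k`, `d_k` -/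

/-- `−log e_k = −log e + (N−k)·(log L)/2` for the running coupling `e_k = L^{−(N−k)/2}e` of (7).
[cite: Dimock2022UVStabilityQED3, §2.1 (7) p.2 L63–68; §4.1 proof of Lemma 17 p.56 L74 («r⁰_{k+1} = (−log e_k − ½log L)^r»)] -/
def negLogCoupling (L : ℕ) (e : ℝ) (N k : ℕ) : ℝ :=
  -Real.log e + ((N - k : ℕ) : ℝ) * (Real.log L / 2)

/-- `r⁰_k = (−log e_k)^r`. [cite: Dimock2022UVStabilityQED3, §4.1 Lemma 17 p.56 L61–62] -/
def radius0 (L : ℕ) (e : ℝ) (r N k : ℕ) : ℝ := negLogCoupling L e N k ^ r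

/-- `log_L r_k`: the exponent of the smallest power of `L` `≥ r⁰_k`. [cite: Dimock2022UVStabilityQED3, §4.1 Lemma 17 p.56 L61, (419) p.57 L2] -/
def radiusExp (L : ℕ) (e : ℝ) (r N k : ℕ) : ℕ := powExp L (radius0 L e r N k)

/-- `r_k` = the smallest power of `L` greater than or equal to `r⁰_k = (−log e_k)^r`.
[cite: Dimock2022UVStabilityQED3, §1 p.3 L7–8; §4.1 Lemma 17 p.56 L61–62] -/
def radius (L : ℕ) (e : ℝ) (r N k : ℕ) : ℝ := (L : ℝ) ^ radiusExp L e r N k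

/-- `d_k = (N − k) − log_L(M r_k) = (N − k) − log_L r_k − m` (with `M = L^m`), an integer.
[cite: Dimock2022UVStabilityQED3, §4.1 proof of Lemma 17 (2), (419) p.57 L1–2] -/
def dSeq (L : ℕ) (e : ℝ) (r m N k : ℕ) : ℤ :=
  ((N - k : ℕ) : ℤ) - (radiusExp L e r N k : ℤ) - (m : ℤ)

variable {e : ℝ} {r m N k K : ℕ}

/-- `negLogCoupling` IS `−log e_k` for the tree's `runningCoupling` at `ρ = (√L)⁻¹` (`e_k = e·L^{−(N−k)/2}`).
[cite: Dimock2022UVStabilityQED3, §2.1 (7) p.2 L63–68] -/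
theorem negLogCoupling_eq (hL : 0 < L) (he : 0 < e) (N k : ℕ) :
    negLogCoupling L e N k = -Real.log (runningCoupling (Real.sqrt (L : ℝ))⁻¹ e N k) := by
  have hL' : (0 : ℝ) < L := by exact_mod_cast hL
  have hs : Real.sqrt (L : ℝ) ≠ 0 := Real.sqrt_ne_zero'.2 hL'
  unfold negLogCoupling runningCoupling
  rw [Real.log_mul he.ne' (pow_ne_zero _ (inv_ne_zero hs)), Real.log_pow, Real.log_inv,
    Real.log_sqrt hL'.le]
  ring

/-- One step down the scales: `−log e_{k+1} = −log e_k − ½ log L` for `k < N` («since `e_{k+1} = L^{1/2} e_k`», p.56 L74).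
[cite: Dimock2022UVStabilityQED3, §4.1 proof of Lemma 17 (1) p.56 L74] -/
theorem negLogCoupling_succ (hk : k < N) :
    negLogCoupling L e N (k + 1) = negLogCoupling L e N k - Real.log L / 2 := by
  unfold negLogCoupling
  have h : (N - k : ℕ) = (N - (k + 1)) + 1 := by omega
  rw [h]
  push_cast
  ring

/-- `−log e_k ≥ −log e` for `L ≥ 1` (`e_k ≤ e`). [cite: Dimock2022UVStabilityQED3, §2.1 (7) p.2 L63–68] -/
theorem negLog_le_negLogCoupling (hL : 1 ≤ L) (N k : ℕ) : -Real.log e ≤ negLogCoupling L e N k := by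
  unfold negLogCoupling
  have : 0 ≤ Real.log L := Real.log_nonneg (by exact_mod_cast hL)
  have : (0 : ℝ) ≤ ((N - k : ℕ) : ℝ) * (Real.log L / 2) := by positivity
  linarith

/-- `N − K` written through `−log e_K`: `−log e_K = −log e + (N−K)·½log L` (the `a + bx` of (420)).
[cite: Dimock2022UVStabilityQED3, §4.1 proof of Lemma 17 (3), (420) p.57 L7–15] -/
theorem negLogCoupling_def (L : ℕ) (e : ℝ) (N k : ℕ) :
    negLogCoupling L e N k = -Real.log e + ((N - k : ℕ) : ℝ) * (Real.log L / 2) := rfl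

/-! ## §3 LEMMA 17 (1): `r_{k+1} = L^{−1} r_k` or `r_k` -/

/-- **Lemma 17 (1), exponent form**: for `L ≥ 2`, `r ≥ 1`, `k < N` and `e_k ≤ L^{−r}` (i.e. `r log L ≤ −log e_k`, the
explicit content of «for `e_k` sufficiently small»), `log_L r_{k+1} = log_L r_k` or `log_L r_k − 1`.
[cite: Dimock2022UVStabilityQED3, §4.1 Lemma 17 (1) p.56 L63, proof L69–88 with (418)] -/
theorem radiusExp_succ (hL : 2 ≤ L) (hr : 1 ≤ r) (hk : k < N)
    (hsmall : (r : ℝ) * Real.log L ≤ negLogCoupling L e N k) :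
    radiusExp L e r N (k + 1) = radiusExp L e r N k ∨ radiusExp L e r N (k + 1) + 1 = radiusExp L e r N k := by
  have hlogL : 0 < Real.log L := Real.log_pos (by exact_mod_cast (by omega : 1 < L))
  set a := negLogCoupling L e N k with ha
  set b := Real.log L / 2 with hb
  have hb0 : 0 ≤ b := by positivity
  have hr1 : (1 : ℝ) ≤ r := by exact_mod_cast hr
  have hab : 2 * r * b ≤ a := by rw [hb]; linarith
  have hba : b ≤ a := by nlinarith
  have hy : radius0 L e r N (k + 1) = (a - b) ^ r := by
    unfold radius0; rw [negLogCoupling_succ hk]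
  have hx : radius0 L e r N k = a ^ r := rfl
  have hyx : radius0 L e r N (k + 1) ≤ radius0 L e r N k := by
    rw [hy, hx]
    exact pow_le_pow_left₀ (sub_nonneg.2 hba) (sub_le_self a hb0) r
  have hxy : radius0 L e r N k ≤ 2 * radius0 L e r N (k + 1) := by
    rw [hy, hx]
    have := half_pow_le_sub_pow hb0 hab
    linarith
  exact powExp_step hL hyx hxy

/-- **Lemma 17 (1), as printed**: `r_{k+1} = L^{−1} r_k` or `r_{k+1} = r_k`.
[cite: Dimock2022UVStabilityQED3, §4.1 Lemma 17 (1) p.56 L63] -/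
theorem radius_succ (hL : 2 ≤ L) (hr : 1 ≤ r) (hk : k < N)
    (hsmall : (r : ℝ) * Real.log L ≤ negLogCoupling L e N k) :
    radius L e r N (k + 1) = (L : ℝ)⁻¹ * radius L e r N k ∨ radius L e r N (k + 1) = radius L e r N k := by
  have hL0 : (L : ℝ) ≠ 0 := by exact_mod_cast (by omega : L ≠ 0)
  unfold radius
  rcases radiusExp_succ hL hr hk hsmall with h | h
  · exact Or.inr (by rw [h])
  · refine Or.inl ?_
    rw [← h, pow_succ]
    field_simp

/-- The uniform form of the smallness condition: `e ≤ L^{−r}` (`r log L ≤ −log e`) gives `r log L ≤ −log e_k` for ALL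
`k` («let `e` (hence `e_k`) be sufficiently small», Thm 1 p.7 L53–54). [cite: Dimock2022UVStabilityQED3, §2.3 Thm 1 p.7 L53–54; §4.1 p.56 L77] -/
theorem smallness_all (hL : 1 ≤ L) (hsmall : (r : ℝ) * Real.log L ≤ -Real.log e) (N k : ℕ) :
    (r : ℝ) * Real.log L ≤ negLogCoupling L e N k :=
  hsmall.trans (negLog_le_negLogCoupling hL N k)

/-! ## §4 LEMMA 17 (2): the stop point `K < N` with `M r_K = L^{N−K}` -/

/-- `d_{k+1} = d_k` or `d_k − 1` («Since `log_L r_k` only decreases by 0, 1», p.57 L4).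
[cite: Dimock2022UVStabilityQED3, §4.1 proof of Lemma 17 (2) p.57 L1–5] -/
theorem dSeq_succ (hL : 2 ≤ L) (hr : 1 ≤ r) (hk : k < N)
    (hsmall : (r : ℝ) * Real.log L ≤ negLogCoupling L e N k) :
    dSeq L e r m N (k + 1) = dSeq L e r m N k ∨ dSeq L e r m N (k + 1) = dSeq L e r m N k - 1 := by
  unfold dSeq
  have hcast : ((N - k : ℕ) : ℤ) = ((N - (k + 1) : ℕ) : ℤ) + 1 := by omega
  rcases radiusExp_succ hL hr hk hsmall with h | h
  · right; rw [h, hcast]; ring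
  · left; rw [← h, hcast]; push_cast; ring

/-- `d_N < 0` («eventually goes negative at `k = N`», p.57 L4; needs `M = L^m` with `m ≥ 1`, i.e. `M > 1`).
[cite: Dimock2022UVStabilityQED3, §4.1 proof of Lemma 17 (2) p.57 L3–4] -/
theorem dSeq_last_neg (hm : 1 ≤ m) : dSeq L e r m N N < 0 := by
  unfold dSeq
  simp only [Nat.sub_self, Nat.cast_zero, zero_sub]
  omega

/-- The discrete intermediate-value step of the printed proof («starts out positive … eventually goes negative at
`k = N`. Since `log_L r_k` only decreases by 0, 1 there must be a point `k = K` where `d_K = 0`»): an integer sequence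
that moves by `0` or `−1`, starts `≥ 0` and is `< 0` at `N` vanishes at some `K < N`.
[cite: Dimock2022UVStabilityQED3, §4.1 proof of Lemma 17 (2) p.57 L3–5] -/
theorem exists_zero_of_unit_steps {d : ℕ → ℤ} {N : ℕ}
    (hstep : ∀ k, k < N → d (k + 1) = d k ∨ d (k + 1) = d k - 1) (h0 : 0 ≤ d 0) (hN : d N < 0) :
    ∃ K, K < N ∧ d K = 0 := by
  induction N with
  | zero => exact absurd hN (not_lt.2 h0)
  | succ N ih =>
    by_cases hdN : d N < 0
    · obtain ⟨K, hK, hK0⟩ := ih (fun k hk => hstep k (Nat.lt_succ_of_lt hk)) hdN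
      exact ⟨K, Nat.lt_succ_of_lt hK, hK0⟩
    · push Not at hdN
      rcases hstep N (Nat.lt_succ_self N) with h | h
      · exact absurd (h ▸ hN) (not_lt.2 hdN)
      · exact ⟨N, Nat.lt_succ_self N, by omega⟩

/-- **Lemma 17 (2)**: for `L ≥ 2`, `r ≥ 1`, `M = L^m` with `m ≥ 1`, `e ≤ L^{−r}`, and `d_0 ≥ 0` (the content of «for `N`
sufficiently large», see `dSeq_zero_pos_of_large`), there is a `K < N` with `d_K = 0`, i.e. `M r_K = L^{N−K}`.
[cite: Dimock2022UVStabilityQED3, §4.1 Lemma 17 (2) p.56 L64–65, proof (419) p.57 L1–5; p.54 L81–83] -/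
theorem exists_stopPoint (hL : 2 ≤ L) (hr : 1 ≤ r) (hm : 1 ≤ m)
    (hsmall : (r : ℝ) * Real.log L ≤ -Real.log e) (hd0 : 0 ≤ dSeq L e r m N 0) :
    ∃ K, K < N ∧ dSeq L e r m N K = 0 :=
  exists_zero_of_unit_steps (fun k hk => dSeq_succ hL hr hk (smallness_all (by omega) hsmall N k)) hd0
    (dSeq_last_neg hm)

open Classical in
/-- **The stop point `K`** — «there are indices `k = K` such that `M r_K = L^{N−K}` exactly, and we take the first
such» (p.54 L82); «we stop the iteration at the first point `K` satisfying `K = K₀ − log_L r_K = N − log_L M − log_L r_K`»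
(p.7 L50–51): the least `K` with `d_K = 0`, given that one exists (`exists_stopPoint`).
[cite: Dimock2022UVStabilityQED3, §4.1 p.54 L81–83; §2.3 p.7 L50–52] -/
def stopPoint (h : ∃ K, K < N ∧ dSeq L e r m N K = 0) : ℕ := Nat.find h

/-- The stop point satisfies `K < N` and `d_K = 0` (`M r_K = L^{N−K}`). [cite: Dimock2022UVStabilityQED3, §4.1 Lemma 17 (2) p.56 L64–65] -/
theorem stopPoint_spec (h : ∃ K, K < N ∧ dSeq L e r m N K = 0) :
    stopPoint h < N ∧ dSeq L e r m N (stopPoint h) = 0 := by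
  classical
  exact Nat.find_spec h

/-- «the first such»: no `k < K` has `d_k = 0`. [cite: Dimock2022UVStabilityQED3, §4.1 p.54 L82 («we take the first such»)] -/
theorem dSeq_ne_zero_of_lt_stopPoint (h : ∃ K, K < N ∧ dSeq L e r m N K = 0) (hk : k < stopPoint h) :
    dSeq L e r m N k ≠ 0 := by
  classical
  intro hk0
  exact Nat.find_min h hk ⟨hk.trans (Nat.find_spec h).1, hk0⟩

/-- The stop-point equation in the printed multiplicative form: `d_K = 0 ⟺ log_L r_K + m = N − K`, whence
`M r_K = L^m · r_K = L^{N−K}` («so `|T⁰_{N−K}| = (M r_K)^3`»). [cite: Dimock2022UVStabilityQED3, §4.1 Lemma 17 (2) p.56 L64–65; p.54 L81–82] -/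
theorem radius_mul_M_eq (hd : dSeq L e r m N K = 0) :
    (L : ℝ) ^ m * radius L e r N K = (L : ℝ) ^ (N - K) := by
  unfold dSeq at hd
  have h : radiusExp L e r N K + m = N - K := by omega
  unfold radius
  rw [← pow_add, add_comm, h]

/-- `d_K = 0` unpacked: `log_L r_K + m = N − K` (as natural numbers). [cite: Dimock2022UVStabilityQED3, §4.1 (419) p.57 L2, L7 («N − K = log_L r_K + m»)] -/
theorem radiusExp_add_eq (hd : dSeq L e r m N K = 0) : radiusExp L e r N K + m = N - K := by
  unfold dSeq at hd; omega

/-- An explicit logarithmic bound on `log_L r_k`: if `−log e_k ≥ 1` then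
`(log_L r_k)·log L ≤ log L + r·log(−log e_k)` (from `L^{n−1} < r⁰_k` when `log_L r_k ≥ 1`; trivial when `log_L r_k = 0`;
the remaining case `−log e_k < 1` has `r⁰_k < 1`, `log_L r_k = 0` and is treated at the call sites). Used for (2) «starts out
positive» and for (3).
[cite: Dimock2022UVStabilityQED3, §4.1 proof of Lemma 17 (3) p.57 L7–8 («N − K ≤ log_L r⁰_K + m + 1»)] -/
theorem radiusExp_log_le (hL : 2 ≤ L) (hpos : 1 ≤ negLogCoupling L e N k) :
    (radiusExp L e r N k : ℝ) * Real.log L ≤ Real.log L + r * Real.log (negLogCoupling L e N k) := by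
  have hL1 : 1 < L := by omega
  have hlogL : 0 < Real.log L := Real.log_pos (by exact_mod_cast hL1)
  have hlogA : 0 ≤ Real.log (negLogCoupling L e N k) := Real.log_nonneg hpos
  rcases Nat.eq_zero_or_pos (radiusExp L e r N k) with h0 | h1
  · rw [h0]; simp only [Nat.cast_zero, zero_mul]; positivity
  · have h := sub_one_mul_log_lt hL1 (show 1 ≤ powExp L (radius0 L e r N k) from h1)
    unfold radius0 at h
    rw [Real.log_pow] at h
    change ((radiusExp L e r N k : ℝ) - 1) * Real.log L < r * Real.log (negLogCoupling L e N k) at h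
    nlinarith

/-- «This starts out positive for `N` sufficiently large (since `log_L r_k` grows logarithmically in `N`)» — made
explicit: for `L ≥ 2`, `r ≥ 1`, `0 < e ≤ 1`, `d_0 > 0` as soon as `3N > 4(m + 1) + (−2log e + 4r log(2r))/log L`.
[cite: Dimock2022UVStabilityQED3, §4.1 proof of Lemma 17 (2) p.57 L3–4] -/
theorem dSeq_zero_pos_of_large (hL : 2 ≤ L) (hr : 1 ≤ r) (he0 : 0 < e) (he1 : e ≤ 1)
    (hN : 4 * ((m : ℝ) + 1) + (-2 * Real.log e + 4 * r * Real.log (2 * r)) / Real.log L < 3 * N) :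
    0 < dSeq L e r m N 0 := by
  have hL1 : 1 < L := by omega
  have hlogL : 0 < Real.log L := Real.log_pos (by exact_mod_cast hL1)
  have hr0 : (0 : ℝ) < r := by exact_mod_cast (by omega : 0 < r)
  have hloge : Real.log e ≤ 0 := Real.log_nonpos he0.le he1
  have hlog2r : 0 ≤ Real.log (2 * r) := Real.log_nonneg (by linarith [show (1:ℝ) ≤ r by exact_mod_cast hr])
  -- it suffices to bound `n_0 = log_L r_0` by `N − m − 1` from above, as reals
  suffices h : (radiusExp L e r N 0 : ℝ) < (N : ℝ) - m by
    unfold dSeq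
    simp only [Nat.sub_zero]
    have : (radiusExp L e r N 0 : ℤ) < (N : ℤ) - m := by exact_mod_cast h
    omega
  set A := negLogCoupling L e N 0 with hA
  have hAdef : A = -Real.log e + (N : ℝ) * (Real.log L / 2) := by
    rw [hA, negLogCoupling_def]; simp
  by_cases hA1 : 1 ≤ A
  · -- logarithmic case: `n_0 log L ≤ log L + r log A` and `log A ≤ A/(2r) − 1 + log(2r)`
    have hApos : 0 < A := by linarith
    have hlogA : Real.log A ≤ A / (2 * r) - 1 + Real.log (2 * r) := by
      have h := Real.log_le_sub_one_of_pos (show 0 < A / (2 * r) by positivity)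
      rw [Real.log_div hApos.ne' (by positivity)] at h
      linarith
    have h1 := radiusExp_log_le (r := r) hL hA1
    -- `n_0 log L ≤ log L + r (A/(2r) − 1 + log 2r) = log L + A/2 − r + r log(2r)`
    have h2 : (radiusExp L e r N 0 : ℝ) * Real.log L
        ≤ Real.log L + A / 2 - r + r * Real.log (2 * r) := by
      have : (r : ℝ) * Real.log A ≤ r * (A / (2 * r) - 1 + Real.log (2 * r)) :=
        mul_le_mul_of_nonneg_left hlogA hr0.le
      have hrr : (r : ℝ) * (A / (2 * r) - 1 + Real.log (2 * r)) = A / 2 - r + r * Real.log (2 * r) := by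
        field_simp
      linarith
    -- divide by `log L` and use `A/2 = −log e/2 + N log L/4`
    have h3 : (radiusExp L e r N 0 : ℝ) * Real.log L < ((N : ℝ) - m) * Real.log L := by
      have hN' : 4 * ((m : ℝ) + 1) * Real.log L + (-2 * Real.log e + 4 * r * Real.log (2 * r))
          < 3 * N * Real.log L := by
        have := (div_lt_iff₀ hlogL).1 (show (-2 * Real.log e + 4 * r * Real.log (2 * r)) / Real.log L
          < 3 * N - 4 * ((m : ℝ) + 1) by linarith)
        nlinarith
      rw [hAdef] at h2
      nlinarith
    exact lt_of_mul_lt_mul_right h3 hlogL.le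
  · -- `A < 1`: `r⁰_0 = A^r ≤ 1`, so `n_0 = 0 < N − m`
    push Not at hA1
    have hA0 : 0 ≤ A := by rw [hAdef]; nlinarith
    have hz : radiusExp L e r N 0 = 0 :=
      powExp_eq_zero_of_le_one hL1 (pow_le_one₀ hA0 hA1.le)
    rw [hz, Nat.cast_zero]
    have : (-2 * Real.log e + 4 * r * Real.log (2 * r)) / Real.log L ≥ 0 := by
      apply div_nonneg _ hlogL.le; nlinarith
    nlinarith

/-! ## §5 LEMMA 17 (3): `N − K` is bounded by a constant independent of `N` -/

/-- **Lemma 17 (3), explicit**: for `L ≥ 2`, `r ≥ 1`, `0 < e ≤ 1` and ANY `K` with `d_K = 0` (`M r_K = L^{N−K}`),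
`N − K ≤ 2(m+1) + (−2 log e + 2 r log r)/log L` — a constant independent of `N` («`x = N − K` satisfies an inequality
of the form `x ≤ r log_L(a + bx) + c` with positive constants `a, b, c` independent of `N`», p.57 L15–18).
[cite: Dimock2022UVStabilityQED3, §4.1 Lemma 17 (3) p.56 L66–67, proof (420) p.57 L6–18] -/
theorem stopGap_le (hL : 2 ≤ L) (hr : 1 ≤ r) (he0 : 0 < e) (he1 : e ≤ 1) (hd : dSeq L e r m N K = 0) :
    ((N - K : ℕ) : ℝ) ≤ 2 * ((m : ℝ) + 1) + (-2 * Real.log e + 2 * r * Real.log r) / Real.log L := by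
  have hL1 : 1 < L := by omega
  have hlogL : 0 < Real.log L := Real.log_pos (by exact_mod_cast hL1)
  have hr0 : (0 : ℝ) < r := by exact_mod_cast (by omega : 0 < r)
  have hloge : Real.log e ≤ 0 := Real.log_nonpos he0.le he1
  have hlogr : 0 ≤ Real.log r := Real.log_nonneg (by exact_mod_cast hr)
  have hfrac : 0 ≤ (-2 * Real.log e + 2 * r * Real.log r) / Real.log L := by
    apply div_nonneg _ hlogL.le; nlinarith
  have hx : radiusExp L e r N K + m = N - K := radiusExp_add_eq hd
  set x : ℕ := N - K with hxdef
  set A := negLogCoupling L e N K with hA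
  have hAdef : A = -Real.log e + (x : ℝ) * (Real.log L / 2) := by rw [hA, negLogCoupling_def]
  by_cases hA1 : 1 ≤ A
  · have hApos : 0 < A := by linarith
    -- `log A ≤ A/r − 1 + log r`
    have hlogA : Real.log A ≤ A / r - 1 + Real.log r := by
      have h := Real.log_le_sub_one_of_pos (show 0 < A / r by positivity)
      rw [Real.log_div hApos.ne' hr0.ne'] at h
      linarith
    have h1 := radiusExp_log_le (r := r) hL hA1
    -- `n_K log L ≤ log L + r log A ≤ log L + A − r + r log r`
    have h2 : (radiusExp L e r N K : ℝ) * Real.log L ≤ Real.log L + A - r + r * Real.log r := by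
      have : (r : ℝ) * Real.log A ≤ r * (A / r - 1 + Real.log r) := mul_le_mul_of_nonneg_left hlogA hr0.le
      have hrr : (r : ℝ) * (A / r - 1 + Real.log r) = A - r + r * Real.log r := by field_simp
      linarith
    -- with `n_K = x − m` and `A = −log e + x log L/2`: `(x/2) log L ≤ (m+1) log L − log e + r log r − r`
    have hxn : (radiusExp L e r N K : ℝ) = (x : ℝ) - m := by
      have : ((radiusExp L e r N K + m : ℕ) : ℝ) = (x : ℝ) := by rw [hx]
      push_cast at this; linarith
    rw [hxn, hAdef] at h2
    have h3 : (x : ℝ) * Real.log L ≤ (2 * ((m : ℝ) + 1)) * Real.log L + (-2 * Real.log e + 2 * r * Real.log r) := by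
      nlinarith
    have h4 : (x : ℝ) ≤ 2 * ((m : ℝ) + 1) + (-2 * Real.log e + 2 * r * Real.log r) / Real.log L := by
      rw [add_div' _ _ _ hlogL.ne', le_div_iff₀ hlogL]
      linarith
    exact h4
  · -- `A < 1`: `r⁰_K ≤ 1`, `log_L r_K = 0`, so `N − K = m`
    push Not at hA1
    have hA0 : 0 ≤ A := by
      rw [hAdef]; have : (0:ℝ) ≤ (x : ℝ) * (Real.log L / 2) := by positivity
      linarith
    have hz : radiusExp L e r N K = 0 := powExp_eq_zero_of_le_one hL1 (pow_le_one₀ hA0 hA1.le)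
    rw [hz, zero_add] at hx
    have : (x : ℝ) = m := by rw [← hx]
    rw [this]; linarith

/-- **Lemma 17 (3), the other two quantities**: with `C = 2(m+1) + (−2 log e + 2 r log r)/log L`, also
`M r_K = L^{N−K} ≤ L^C` and `r_K ≤ L^C` («as are `|T⁰_{N−K}| = (M r_K)^3` and `r_K`»), uniformly in `N`.
[cite: Dimock2022UVStabilityQED3, §4.1 Lemma 17 (3) p.56 L66–67] -/
theorem radius_le_of_stopPoint (hL : 2 ≤ L) (hr : 1 ≤ r) (he0 : 0 < e) (he1 : e ≤ 1)
    (hd : dSeq L e r m N K = 0) :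
    (L : ℝ) ^ m * radius L e r N K
        ≤ (L : ℝ) ^ (2 * ((m : ℝ) + 1) + (-2 * Real.log e + 2 * r * Real.log r) / Real.log L) ∧
      radius L e r N K
        ≤ (L : ℝ) ^ (2 * ((m : ℝ) + 1) + (-2 * Real.log e + 2 * r * Real.log r) / Real.log L) := by
  have hL1 : (1 : ℝ) ≤ L := by exact_mod_cast (by omega : 1 ≤ L)
  have hC := stopGap_le hL hr he0 he1 hd
  have hM : (L : ℝ) ^ m * radius L e r N K = (L : ℝ) ^ ((N - K : ℕ) : ℝ) := by
    rw [radius_mul_M_eq hd, Real.rpow_natCast]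
  have h1 : (L : ℝ) ^ m * radius L e r N K
      ≤ (L : ℝ) ^ (2 * ((m : ℝ) + 1) + (-2 * Real.log e + 2 * r * Real.log r) / Real.log L) := by
    rw [hM]; exact Real.rpow_le_rpow_of_exponent_le hL1 hC
  refine ⟨h1, le_trans ?_ h1⟩
  have hrad : 0 ≤ radius L e r N K := by unfold radius; positivity
  calc radius L e r N K = 1 * radius L e r N K := (one_mul _).symm
    _ ≤ (L : ℝ) ^ m * radius L e r N K := mul_le_mul_of_nonneg_right (one_le_pow₀ hL1) hrad

/-! ## §6 (33)–(34): the history-dependent energy shift `|ε⁰_k| ≤ e_k^7` -/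

/-- `e_k = (√L)⁻¹ e_{k+1}` for `k < N` («since `e_k^7 = L^{−7/2} e_{k+1}^7`», p.6 L80–83).
[cite: Dimock2022UVStabilityQED3, §2.1 (7) p.2 L63–68; §2.2 after (33) p.6 L80–83] -/
theorem runningCoupling_eq_mul_succ (ρ e : ℝ) (hk : k < N) :
    runningCoupling ρ e N k = ρ * runningCoupling ρ e N (k + 1) := by
  unfold runningCoupling
  have h : N - k = (N - (k + 1)) + 1 := by omega
  rw [h, pow_succ]; ring

/-- The numerical heart of (34) («since `e_k^7 = L^{−7/2} e_{k+1}^7` this implies …»): for `L ≥ 4` and `p ≥ 7`,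
`2 L³ ((√L)⁻¹)^p ≤ 1` (i.e. `2L³L^{−p/2} ≤ 1`). [cite: Dimock2022UVStabilityQED3, §2.2 between (33) and (34), p.6 L80–83] -/
theorem two_mul_cube_mul_inv_sqrt_pow_le_one (hL : 4 ≤ L) {p : ℕ} (hp : 7 ≤ p) :
    2 * (L : ℝ) ^ 3 * ((Real.sqrt (L : ℝ))⁻¹) ^ p ≤ 1 := by
  have hL' : (4 : ℝ) ≤ L := by exact_mod_cast hL
  have hs2 : (2 : ℝ) ≤ Real.sqrt L := by
    rw [show (2 : ℝ) = Real.sqrt 4 by rw [show (4:ℝ) = 2 ^ 2 by norm_num, Real.sqrt_sq (by norm_num)]]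
    exact Real.sqrt_le_sqrt hL'
  have hs0 : 0 < Real.sqrt (L : ℝ) := by linarith
  have hsq : Real.sqrt (L : ℝ) ^ 2 = L := Real.sq_sqrt (by linarith)
  have hinv1 : (Real.sqrt (L : ℝ))⁻¹ ≤ 1 := inv_le_one_of_one_le₀ (by linarith)
  have hinv0 : 0 ≤ (Real.sqrt (L : ℝ))⁻¹ := by positivity
  -- `ρ^p ≤ ρ^7` and `L³ ρ^7 = ρ · (L ρ²)³ = ρ`
  have h7 : ((Real.sqrt (L : ℝ))⁻¹) ^ p ≤ ((Real.sqrt (L : ℝ))⁻¹) ^ 7 := pow_le_pow_of_le_one hinv0 hinv1 hp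
  have h76 : Real.sqrt (L : ℝ) ^ 7 = (L : ℝ) ^ 3 * Real.sqrt (L : ℝ) := by
    rw [show (7 : ℕ) = 2 * 3 + 1 by norm_num, pow_succ, pow_mul, hsq]
  have hL3 : (L : ℝ) ^ 3 * ((Real.sqrt (L : ℝ))⁻¹) ^ 7 = (Real.sqrt (L : ℝ))⁻¹ := by
    rw [inv_pow, h76, mul_inv, ← mul_assoc, mul_inv_cancel₀ (pow_ne_zero 3 (by positivity)), one_mul]
  calc 2 * (L : ℝ) ^ 3 * ((Real.sqrt (L : ℝ))⁻¹) ^ p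
      ≤ 2 * (L : ℝ) ^ 3 * ((Real.sqrt (L : ℝ))⁻¹) ^ 7 := by gcongr
    _ = 2 * (Real.sqrt (L : ℝ))⁻¹ := by rw [mul_assoc, hL3]
    _ ≤ 1 := by rw [mul_inv_le_iff₀ hs0]; linarith

/-- **(33) ⟹ (34)**: if `ε⁰_0 = 0`, `ε⁰_{k+1} = L³(ε⁰_k + δε⁰_k)` and `|δε⁰_k| ≤ e_k^p` for `k < K ≤ N`, with `L ≥ 4` and
`p ≥ 7` («`|δε⁰_k| ≤ e_k^7` (or any power of `e_k`)»), then `|ε⁰_k| ≤ e_k^p` for all `k ≤ K`; here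
`e_k = runningCoupling (√L)⁻¹ e N k = L^{−(N−k)/2} e`.
[cite: Dimock2022UVStabilityQED3, §2.2 (33)–(34) p.6 L70–86] -/
theorem energyShift_bound (hL : 4 ≤ L) (he : 0 ≤ e) {p : ℕ} (hp : 7 ≤ p) (hKN : K ≤ N)
    (ε₀ δε₀ : ℕ → ℝ) (h0 : ε₀ 0 = 0)
    (hflow : ∀ k, k < K → ε₀ (k + 1) = (L : ℝ) ^ 3 * (ε₀ k + δε₀ k))
    (hδ : ∀ k, k < K → |δε₀ k| ≤ runningCoupling (Real.sqrt (L : ℝ))⁻¹ e N k ^ p) :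
    ∀ k, k ≤ K → |ε₀ k| ≤ runningCoupling (Real.sqrt (L : ℝ))⁻¹ e N k ^ p := by
  set ρ := (Real.sqrt (L : ℝ))⁻¹ with hρ
  have hρ0 : 0 ≤ ρ := by positivity
  have hnum := two_mul_cube_mul_inv_sqrt_pow_le_one hL hp
  intro k
  induction k with
  | zero =>
    intro _
    rw [h0, abs_zero]
    exact pow_nonneg (runningCoupling_nonneg hρ0 he N 0) p
  | succ k ih =>
    intro hk
    have hkK : k < K := Nat.lt_of_succ_le hk
    have hkN : k < N := lt_of_lt_of_le hkK hKN
    have ihk := ih hkK.le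
    have hek : runningCoupling ρ e N k = ρ * runningCoupling ρ e N (k + 1) := runningCoupling_eq_mul_succ ρ e hkN
    have hek1 : 0 ≤ runningCoupling ρ e N (k + 1) := runningCoupling_nonneg hρ0 he N (k + 1)
    have hL3 : (0 : ℝ) ≤ (L : ℝ) ^ 3 := by positivity
    rw [hflow k hkK, abs_mul, abs_of_nonneg hL3]
    calc (L : ℝ) ^ 3 * |ε₀ k + δε₀ k|
        ≤ (L : ℝ) ^ 3 * (|ε₀ k| + |δε₀ k|) := mul_le_mul_of_nonneg_left (abs_add_le _ _) hL3
      _ ≤ (L : ℝ) ^ 3 * (runningCoupling ρ e N k ^ p + runningCoupling ρ e N k ^ p) :=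
          mul_le_mul_of_nonneg_left (add_le_add ihk (hδ k hkK)) hL3
      _ = (2 * (L : ℝ) ^ 3 * ρ ^ p) * runningCoupling ρ e N (k + 1) ^ p := by rw [hek, mul_pow]; ring
      _ ≤ 1 * runningCoupling ρ e N (k + 1) ^ p :=
          mul_le_mul_of_nonneg_right hnum (pow_nonneg hek1 p)
      _ = runningCoupling ρ e N (k + 1) ^ p := one_mul _

/-- **(34) as printed** (`p = 7`): `|ε⁰_k| ≤ e_k^7` for all `k ≤ K`. [cite: Dimock2022UVStabilityQED3, §2.2 (34) p.6 L83–86] -/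
theorem energyShift_bound_seven (hL : 4 ≤ L) (he : 0 ≤ e) (hKN : K ≤ N) (ε₀ δε₀ : ℕ → ℝ) (h0 : ε₀ 0 = 0)
    (hflow : ∀ k, k < K → ε₀ (k + 1) = (L : ℝ) ^ 3 * (ε₀ k + δε₀ k))
    (hδ : ∀ k, k < K → |δε₀ k| ≤ runningCoupling (Real.sqrt (L : ℝ))⁻¹ e N k ^ 7) :
    ∀ k, k ≤ K → |ε₀ k| ≤ runningCoupling (Real.sqrt (L : ℝ))⁻¹ e N k ^ 7 :=
  energyShift_bound hL he le_rfl hKN ε₀ δε₀ h0 hflow hδ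

end QED3StopPoint

end Literature.MathematicalPhysics.QuantumFieldTheory.Dimock2011to13

end
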